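import Summits.HubbardSuperconductivity.HubbardSuperconductivity.Theorems.SoloBlindCanonicalOccupation

/-!
# Grand-canonical variance and the fugacity window of the occupation sandwich
(solo-blind programme, Theorem 25, part 2)

Continuation of `SoloBlindCanonicalOccupation`.  With `e_j(s) = ∑_{T ⊆ s, #T = j} ∏_{k∈T} x_k`
(nonnegative weights) and the independent-mode ("grand-canonical", fugacity `1`) number law
`n ↦ e_n / ∏_k (1 + x_k)`:

* `variance_ge` : `∏_k (1+x_k) · ∑_k x_k/(1+x_k)² ≤ ∑_{T ⊆ s} (#T - c)² ∏_T x` for every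
  centre `c` (second moment ≥ variance `= ∑_k p_k (1 - p_k)`, `p_k = x_k/(1+x_k)`);
* `second_moment_le` : if `2 e_{m-1} ≤ e_m` and `2 e_{m+1} ≤ e_m` then both tails of `(e_n)`
  decay geometrically (strong log-concavity) and `∑_T (#T - m)² ∏_T x ≤ 12 e_m`;
* `fugacity_window` : consequently, at a symmetric point `e_{m-1} = e_{m+1}` (e.g. an
  inversion-closed BCS weight family at half filling of the pairing window) with grand-canonical
  variance `> 12`, one has `e_m < 2 e_{m∓1}`: the two fugacities `z₋ = e_{m-1}/e_m`,
  `z₊ = e_m/e_{m+1}` of the occupation sandwich lie in `(1/2, 2)`, so every canonical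
  occupation at pair number `m` is within a factor `4` of its grand-canonical value, uniformly
  in the number of modes.

This is the finite-size replacement for the equivalence of ensembles needed to evaluate a
number-projected BCS trial state in a fixed sector (report §5.20 (5), claim C53).
-/

namespace Summit.HubbardSuperconductivity.HubbardSuperconductivity.Theorems.CanonicalOccupation

open Finset

variable {α : Type*} [DecidableEq α]

/-- `esy[x, s, j]` = the `j`-th elementary symmetric sum of the weights `x` over the modes `s`. -/
local notation "esy[" x ", " s ", " j "]" =>
  (∑ t ∈ Finset.powersetCard j s, ∏ k ∈ t, x k)

/-! ## Grand-canonical variance and the ratio `e_m / e_{m-1}`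

`Σ_{T ⊆ s} f(#T) Π_T x = Σ_n f(n) e_n(s)` is the (unnormalised) law of the pair number under
the independent-mode (grand-canonical, fugacity `1`) measure, whose normalisation is
`Σ_T Π_T x = Π_k (1 + x_k)` and whose variance is `Σ_k x_k/(1+x_k)²`.  If the number law has a
large second moment about `m`, the ratio `e_m/e_{m-1}` cannot reach `2` (a ratio `≥ 2` at a
quasi-symmetric point forces geometric decay of both tails, hence second moment `≤ 12 e_m`). -/

/-- VARIANCE LOWER BOUND for the independent-mode number law: for every centre `c`,
`(Π_{k∈s} (1 + x_k)) · Σ_{k∈s} x_k/(1+x_k)² ≤ Σ_{T ⊆ s} (#T - c)² Π_{k∈T} x_k`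
(`E(X-c)² ≥ Var X`, by induction on the modes, completing one square per mode). [folklore] -/
theorem variance_ge {x : α → ℝ} {s : Finset α} (hx : ∀ k ∈ s, 0 ≤ x k) (c : ℝ) :
    (∏ k ∈ s, (1 + x k)) * ∑ k ∈ s, x k / (1 + x k) ^ 2 ≤
      ∑ t ∈ s.powerset, ((t.card : ℝ) - c) ^ 2 * ∏ k ∈ t, x k := by
  induction s using Finset.induction_on generalizing c with
  | empty =>
    have := sq_nonneg c
    simpa using this
  | @insert a s ha ih =>
    have hxs : ∀ k ∈ s, 0 ≤ x k := fun k hk => hx k (mem_insert_of_mem hk)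
    have hxa : 0 ≤ x a := hx a (mem_insert_self a s)
    have h1x : 0 < 1 + x a := by linarith
    rw [sum_powerset_insert ha, prod_insert ha, sum_insert ha]
    have h2 : ∑ t ∈ s.powerset, (((insert a t).card : ℝ) - c) ^ 2 * ∏ k ∈ insert a t, x k =
        x a * ∑ t ∈ s.powerset, ((t.card : ℝ) - (c - 1)) ^ 2 * ∏ k ∈ t, x k := by
      rw [mul_sum]
      refine sum_congr rfl fun t ht => ?_
      have hat : a ∉ t := fun h => ha (mem_powerset.1 ht h)
      rw [card_insert_of_notMem hat, prod_insert hat]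
      push_cast
      ring
    rw [h2]
    -- complete the square: `u² + x (u+1)² = (1+x) (u + p)² + x/(1+x)`, `p = x/(1+x)`
    have key : ∀ u : ℝ, (u - c) ^ 2 + x a * (u - (c - 1)) ^ 2 =
        (1 + x a) * (u - (c - x a / (1 + x a))) ^ 2 + x a / (1 + x a) := by
      intro u
      field_simp
      ring
    have hsum : ∑ t ∈ s.powerset, ((t.card : ℝ) - c) ^ 2 * ∏ k ∈ t, x k +
        x a * ∑ t ∈ s.powerset, ((t.card : ℝ) - (c - 1)) ^ 2 * ∏ k ∈ t, x k =
        (1 + x a) * ∑ t ∈ s.powerset, ((t.card : ℝ) - (c - x a / (1 + x a))) ^ 2 * ∏ k ∈ t, x k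
          + x a / (1 + x a) * ∑ t ∈ s.powerset, ∏ k ∈ t, x k := by
      rw [mul_sum, mul_sum, mul_sum, ← sum_add_distrib, ← sum_add_distrib]
      refine sum_congr rfl fun t _ => ?_
      have := key (t.card : ℝ)
      calc ((t.card : ℝ) - c) ^ 2 * ∏ k ∈ t, x k
            + x a * (((t.card : ℝ) - (c - 1)) ^ 2 * ∏ k ∈ t, x k)
          = (((t.card : ℝ) - c) ^ 2 + x a * ((t.card : ℝ) - (c - 1)) ^ 2) * ∏ k ∈ t, x k := by
            ring
        _ = ((1 + x a) * ((t.card : ℝ) - (c - x a / (1 + x a))) ^ 2 + x a / (1 + x a)) *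
              ∏ k ∈ t, x k := by rw [this]
        _ = _ := by ring
    rw [hsum, ← prod_one_add]
    have IH := ih hxs (c - x a / (1 + x a))
    have hZ : 0 ≤ ∏ k ∈ s, (1 + x k) := prod_nonneg fun k hk => by linarith [hxs k hk]
    have e3 : (1 + x a) * (∏ k ∈ s, (1 + x k)) * (x a / (1 + x a) ^ 2) =
        x a / (1 + x a) * ∏ k ∈ s, (1 + x k) := by
      field_simp
    nlinarith [IH, e3, mul_le_mul_of_nonneg_left IH h1x.le]

omit [DecidableEq α] in
/-- The number law in terms of the elementary symmetric sums:
`Σ_{T ⊆ s} f(#T) Π_T x = Σ_{n ≤ #s} f(n) e_n(s)`. [folklore] -/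
theorem sum_powerset_card_mul_prod (x : α → ℝ) (s : Finset α) (f : ℕ → ℝ) :
    ∑ t ∈ s.powerset, f t.card * ∏ k ∈ t, x k =
      ∑ n ∈ range (s.card + 1), f n * esy[x, s, n] := by
  rw [sum_powerset]
  refine sum_congr rfl fun n _ => ?_
  rw [mul_sum]
  refine sum_congr rfl fun t ht => ?_
  rw [(mem_powersetCard.1 ht).2]

omit [DecidableEq α] in
/-- `Σ_T Π_T x = Σ_n e_n = Π (1 + x_k)` and hence `e_m ≤ Π_k (1 + x_k)`. [folklore] -/
theorem esy_le_prod_one_add {x : α → ℝ} {s : Finset α} (hx : ∀ k ∈ s, 0 ≤ x k) (m : ℕ) :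
    esy[x, s, m] ≤ ∏ k ∈ s, (1 + x k) := by
  by_cases hm : s.card < m
  · rw [esy_eq_zero_of_card_lt x hm]
    exact prod_nonneg fun k hk => by linarith [hx k hk]
  · have h := sum_powerset_card_mul_prod x s (fun _ => 1)
    simp only [one_mul] at h
    rw [prod_one_add, h]
    exact single_le_sum (f := fun n => esy[x, s, n]) (fun n _ => esy_nonneg hx n)
      (mem_range.2 (by omega))

/-- RIGHT TAIL: if `e_m > 0` and `2 e_{m+1} ≤ e_m`, then `2^j e_{m+j} ≤ e_m` for all `j`
(the ratios `e_{n+1}/e_n` are non-increasing). [folklore] -/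
theorem tail_right {x : α → ℝ} {s : Finset α} (hx : ∀ k ∈ s, 0 ≤ x k) (m : ℕ)
    (hm : 0 < esy[x, s, m]) (h1 : 2 * esy[x, s, m + 1] ≤ esy[x, s, m]) :
    ∀ j : ℕ, 2 ^ j * esy[x, s, m + j] ≤ esy[x, s, m] := by
  intro j
  induction j with
  | zero => simp
  | succ j ih =>
    cases j with
    | zero => simpa using h1
    | succ j =>
      have hlc := esy_mul_esy_le hx m (m + j) (by omega)
      have e1 : m + j + 2 = m + (j + 1 + 1) := by omega
      have e2 : m + j + 1 = m + (j + 1) := by omega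
      rw [e1, e2] at hlc
      have hE := esy_nonneg hx (x := x) (s := s)
      have hP : (0 : ℝ) ≤ 2 ^ (j + 1) := by positivity
      -- e_m · (2^{j+2} e_{m+j+2}) ≤ 2^{j+1}·2·e_{m+1} e_{m+j+1} ≤ 2^{j+1} e_m e_{m+j+1} ≤ e_m²
      have F1 := mul_le_mul_of_nonneg_left hlc hP
      have F2 := mul_le_mul_of_nonneg_left h1 (mul_nonneg hP (hE (m + (j + 1))))
      have F3 := mul_le_mul_of_nonneg_left ih hm.le
      have step : esy[x, s, m] * (2 ^ (j + 1 + 1) * esy[x, s, m + (j + 1 + 1)]) ≤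
          esy[x, s, m] * esy[x, s, m] := by
        rw [pow_succ]
        nlinarith [F1, F2, F3]
      exact le_of_mul_le_mul_left step hm

/-- LEFT TAIL: if `e_m > 0` (with `m = m₀ + 1`) and `2 e_{m-1} ≤ e_m`, then `2^j e_{m-j} ≤ e_m`
for all `j ≤ m`, stated as `m = n + j → 2^j e_n ≤ e_m`. [folklore] -/
theorem tail_left {x : α → ℝ} {s : Finset α} (hx : ∀ k ∈ s, 0 ≤ x k) (m₀ : ℕ)
    (hm : 0 < esy[x, s, m₀ + 1]) (h1 : 2 * esy[x, s, m₀] ≤ esy[x, s, m₀ + 1]) :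
    ∀ j n : ℕ, m₀ + 1 = n + j → 2 ^ j * esy[x, s, n] ≤ esy[x, s, m₀ + 1] := by
  intro j
  induction j with
  | zero =>
    intro n hn
    have : n = m₀ + 1 := by omega
    subst this
    simp
  | succ j ih =>
    intro n hn
    have IH := ih (n + 1) (by omega)
    -- `e_n ≤ e_{n+1} / 2`
    have hhalf : 2 * esy[x, s, n] ≤ esy[x, s, n + 1] := by
      cases j with
      | zero =>
        have : n = m₀ := by omega
        subst this
        exact h1
      | succ j₁ =>
        -- strong log-concavity with `i = n`, `j' = n + j₁`: e_n e_{n+j₁+2} ≤ e_{n+1} e_{n+j₁+1}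
        have hlc := esy_mul_esy_le hx n (n + j₁) (by omega)
        have e1 : n + j₁ + 2 = m₀ + 1 := by omega
        have e2 : n + j₁ + 1 = m₀ := by omega
        rw [e1, e2] at hlc
        have hE := esy_nonneg hx (x := x) (s := s)
        have F2 := mul_le_mul_of_nonneg_left h1 (hE (n + 1))
        have step : esy[x, s, m₀ + 1] * (2 * esy[x, s, n]) ≤
            esy[x, s, m₀ + 1] * esy[x, s, n + 1] := by nlinarith [hlc, F2]
        exact le_of_mul_le_mul_left step hm
    have hP : (0 : ℝ) ≤ 2 ^ j := by positivity
    calc 2 ^ (j + 1) * esy[x, s, n] = 2 ^ j * (2 * esy[x, s, n]) := by ring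
      _ ≤ 2 ^ j * esy[x, s, n + 1] := mul_le_mul_of_nonneg_left hhalf hP
      _ ≤ esy[x, s, m₀ + 1] := IH

/-- `Σ_{d ≤ D} d² / 2^d = 6 - (D² + 4 D + 6)/2^D`. [folklore] -/
theorem sum_sq_div_two_pow (D : ℕ) :
    ∑ d ∈ range (D + 1), ((d : ℝ) ^ 2 / 2 ^ d) = 6 - ((D : ℝ) ^ 2 + 4 * D + 6) / 2 ^ D := by
  induction D with
  | zero => simp
  | succ D ih =>
    rw [sum_range_succ, ih]
    push_cast
    field_simp
    ring

/-- `Σ_{d ∈ S} d² / 2^d ≤ 6` for every finite `S ⊆ ℕ`. [folklore] -/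
theorem sum_sq_div_two_pow_le (S : Finset ℕ) : ∑ d ∈ S, ((d : ℝ) ^ 2 / 2 ^ d) ≤ 6 := by
  have hsub : S ⊆ range (S.sup id + 1) := fun d hd =>
    mem_range.2 (Nat.lt_succ_of_le (le_sup (f := id) hd))
  calc ∑ d ∈ S, ((d : ℝ) ^ 2 / 2 ^ d) ≤ ∑ d ∈ range (S.sup id + 1), ((d : ℝ) ^ 2 / 2 ^ d) :=
        sum_le_sum_of_subset_of_nonneg hsub fun d _ _ => by positivity
    _ = 6 - (((S.sup id : ℕ) : ℝ) ^ 2 + 4 * (S.sup id : ℕ) + 6) / 2 ^ (S.sup id) :=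
        sum_sq_div_two_pow _
    _ ≤ 6 := by
        have : (0 : ℝ) ≤ (((S.sup id : ℕ) : ℝ) ^ 2 + 4 * (S.sup id : ℕ) + 6) / 2 ^ (S.sup id) := by
          positivity
        linarith

/-- SECOND-MOMENT BOUND: if `e_m > 0` (`m = m₀ + 1`), `2 e_{m-1} ≤ e_m` and `2 e_{m+1} ≤ e_m`,
then `Σ_{T ⊆ s} (#T - m)² Π_T x ≤ 12 e_m` (both tails decay geometrically with ratio `1/2`,
and `Σ_{d ≥ 1} d² 2^{-d} = 6`). [new] -/
theorem second_moment_le {x : α → ℝ} {s : Finset α} (hx : ∀ k ∈ s, 0 ≤ x k) (m₀ : ℕ)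
    (hm : 0 < esy[x, s, m₀ + 1]) (hL : 2 * esy[x, s, m₀] ≤ esy[x, s, m₀ + 1])
    (hR : 2 * esy[x, s, m₀ + 2] ≤ esy[x, s, m₀ + 1]) :
    ∑ t ∈ s.powerset, ((t.card : ℝ) - (m₀ + 1)) ^ 2 * ∏ k ∈ t, x k ≤
      12 * esy[x, s, m₀ + 1] := by
  have hconv := sum_powerset_card_mul_prod x s (fun n => ((n : ℝ) - (m₀ + 1)) ^ 2)
  simp only at hconv
  rw [hconv]
  -- pointwise: (n - m)² e_n ≤ e_m · d(n)²/2^{d(n)}, d(n) = |n - m|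
  have hE := esy_nonneg hx (x := x) (s := s)
  have hpt : ∀ n : ℕ, ((n : ℝ) - (m₀ + 1)) ^ 2 * esy[x, s, n] ≤
      esy[x, s, m₀ + 1] * (((n - (m₀ + 1) + (m₀ + 1 - n) : ℕ) : ℝ) ^ 2 /
        2 ^ (n - (m₀ + 1) + (m₀ + 1 - n))) := by
    intro n
    rcases Nat.lt_or_ge n (m₀ + 1) with hlt | hle
    · -- n + j = m, j ≥ 1
      obtain ⟨j, hj⟩ : ∃ j, m₀ + 1 = n + j := ⟨m₀ + 1 - n, by omega⟩
      have hd : n - (m₀ + 1) + (m₀ + 1 - n) = j := by omega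
      rw [hd]
      have ht := tail_left hx m₀ hm hL j n hj
      have hP : (0 : ℝ) < 2 ^ j := by positivity
      rw [mul_div_assoc', le_div_iff₀ hP]
      have hcast : ((n : ℝ) - (m₀ + 1)) ^ 2 = (j : ℝ) ^ 2 := by
        have : ((m₀ + 1 : ℕ) : ℝ) = n + j := by exact_mod_cast hj
        push_cast at this
        nlinarith [this]
      rw [hcast]
      nlinarith [ht, sq_nonneg (j : ℝ)]
    · -- n = m + j
      obtain ⟨j, rfl⟩ := Nat.exists_eq_add_of_le hle
      have hd : m₀ + 1 + j - (m₀ + 1) + (m₀ + 1 - (m₀ + 1 + j)) = j := by omega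
      rw [hd]
      have ht := tail_right hx (m₀ + 1) hm hR j
      have hP : (0 : ℝ) < 2 ^ j := by positivity
      rw [mul_div_assoc', le_div_iff₀ hP]
      push_cast
      nlinarith [ht, sq_nonneg (j : ℝ)]
  -- sum the pointwise bound and split the index set at m
  have hsum_le : ∑ n ∈ range (s.card + 1),
      (((n - (m₀ + 1) + (m₀ + 1 - n) : ℕ) : ℝ) ^ 2 / 2 ^ (n - (m₀ + 1) + (m₀ + 1 - n))) ≤ 12 := by
    rw [← sum_filter_add_sum_filter_not (range (s.card + 1)) (fun n => m₀ + 1 ≤ n)]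
    have hA : ∑ n ∈ (range (s.card + 1)).filter (fun n => m₀ + 1 ≤ n),
        (((n - (m₀ + 1) + (m₀ + 1 - n) : ℕ) : ℝ) ^ 2 / 2 ^ (n - (m₀ + 1) + (m₀ + 1 - n))) ≤ 6 := by
      rw [← sum_image (s := (range (s.card + 1)).filter (fun n => m₀ + 1 ≤ n))
        (g := fun n => n - (m₀ + 1) + (m₀ + 1 - n)) (f := fun d : ℕ => ((d : ℝ) ^ 2 / 2 ^ d))]
      · exact sum_sq_div_two_pow_le _
      · intro n₁ hn₁ n₂ hn₂ heq
        have h1 := (mem_filter.1 (mem_coe.1 hn₁)).2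
        have h2 := (mem_filter.1 (mem_coe.1 hn₂)).2
        simp only at heq
        omega
    have hB : ∑ n ∈ (range (s.card + 1)).filter (fun n => ¬ m₀ + 1 ≤ n),
        (((n - (m₀ + 1) + (m₀ + 1 - n) : ℕ) : ℝ) ^ 2 / 2 ^ (n - (m₀ + 1) + (m₀ + 1 - n))) ≤ 6 := by
      rw [← sum_image (s := (range (s.card + 1)).filter (fun n => ¬ m₀ + 1 ≤ n))
        (g := fun n => n - (m₀ + 1) + (m₀ + 1 - n)) (f := fun d : ℕ => ((d : ℝ) ^ 2 / 2 ^ d))]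
      · exact sum_sq_div_two_pow_le _
      · intro n₁ hn₁ n₂ hn₂ heq
        have h1 := (mem_filter.1 (mem_coe.1 hn₁)).2
        have h2 := (mem_filter.1 (mem_coe.1 hn₂)).2
        simp only at heq
        omega
    linarith
  calc ∑ n ∈ range (s.card + 1), ((n : ℝ) - (m₀ + 1)) ^ 2 * esy[x, s, n]
      ≤ ∑ n ∈ range (s.card + 1), esy[x, s, m₀ + 1] *
          (((n - (m₀ + 1) + (m₀ + 1 - n) : ℕ) : ℝ) ^ 2 / 2 ^ (n - (m₀ + 1) + (m₀ + 1 - n))) :=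
        sum_le_sum fun n _ => hpt n
    _ = esy[x, s, m₀ + 1] * ∑ n ∈ range (s.card + 1),
          (((n - (m₀ + 1) + (m₀ + 1 - n) : ℕ) : ℝ) ^ 2 / 2 ^ (n - (m₀ + 1) + (m₀ + 1 - n))) := by
        rw [mul_sum]
    _ ≤ esy[x, s, m₀ + 1] * 12 := mul_le_mul_of_nonneg_left hsum_le hm.le
    _ = 12 * esy[x, s, m₀ + 1] := by ring

/-- RATIO BOUND (left): if `e_m > 0`, `e_{m+1} ≤ e_{m-1}` (e.g. at the symmetric point of an
inversion-closed weight family) and the second moment of the number law about `m` exceeds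
`12 e_m`, then `e_m < 2 e_{m-1}`, i.e. the lower fugacity `z₋ = e_{m-1}/e_m > 1/2`. [new] -/
theorem esy_lt_two_mul_esy_pred {x : α → ℝ} {s : Finset α} (hx : ∀ k ∈ s, 0 ≤ x k) (m₀ : ℕ)
    (hm : 0 < esy[x, s, m₀ + 1]) (hsym : esy[x, s, m₀ + 2] ≤ esy[x, s, m₀])
    (hvar : 12 * esy[x, s, m₀ + 1] <
      ∑ t ∈ s.powerset, ((t.card : ℝ) - (m₀ + 1)) ^ 2 * ∏ k ∈ t, x k) :
    esy[x, s, m₀ + 1] < 2 * esy[x, s, m₀] := by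
  by_contra hge
  have hge : 2 * esy[x, s, m₀] ≤ esy[x, s, m₀ + 1] := not_lt.1 hge
  have hR : 2 * esy[x, s, m₀ + 2] ≤ esy[x, s, m₀ + 1] := by linarith
  have := second_moment_le hx m₀ hm hge hR
  linarith

/-- RATIO BOUND (right): symmetrically, if `e_{m-1} ≤ e_{m+1}` and the second moment exceeds
`12 e_m`, then `e_m < 2 e_{m+1}`, i.e. the upper fugacity `z₊ = e_m/e_{m+1} < 2`. [new] -/
theorem esy_lt_two_mul_esy_succ {x : α → ℝ} {s : Finset α} (hx : ∀ k ∈ s, 0 ≤ x k) (m₀ : ℕ)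
    (hm : 0 < esy[x, s, m₀ + 1]) (hsym : esy[x, s, m₀] ≤ esy[x, s, m₀ + 2])
    (hvar : 12 * esy[x, s, m₀ + 1] <
      ∑ t ∈ s.powerset, ((t.card : ℝ) - (m₀ + 1)) ^ 2 * ∏ k ∈ t, x k) :
    esy[x, s, m₀ + 1] < 2 * esy[x, s, m₀ + 2] := by
  by_contra hge
  have hge : 2 * esy[x, s, m₀ + 2] ≤ esy[x, s, m₀ + 1] := not_lt.1 hge
  have hL : 2 * esy[x, s, m₀] ≤ esy[x, s, m₀ + 1] := by linarith
  have := second_moment_le hx m₀ hm hL hge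
  linarith

/-- THE FUGACITY WINDOW in grand-canonical terms: if `e_m > 0`, `e_{m-1} = e_{m+1}` (symmetric
point) and the independent-mode variance `Σ_k x_k/(1+x_k)²` exceeds `12`, then
`e_{m-1} = e_{m+1} > e_m / 2`; hence both fugacities of the occupation sandwich lie in
`(1/2, 2)` and every canonical occupation at pair number `m` is within a factor `4` of its
grand-canonical value. [new] -/
theorem fugacity_window {x : α → ℝ} {s : Finset α} (hx : ∀ k ∈ s, 0 ≤ x k) (m₀ : ℕ)
    (hm : 0 < esy[x, s, m₀ + 1]) (hsym : esy[x, s, m₀] = esy[x, s, m₀ + 2])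
    (hV : 12 < ∑ k ∈ s, x k / (1 + x k) ^ 2) :
    esy[x, s, m₀ + 1] < 2 * esy[x, s, m₀] ∧ esy[x, s, m₀ + 1] < 2 * esy[x, s, m₀ + 2] := by
  have hZ : esy[x, s, m₀ + 1] ≤ ∏ k ∈ s, (1 + x k) := esy_le_prod_one_add hx _
  have hvar : 12 * esy[x, s, m₀ + 1] <
      ∑ t ∈ s.powerset, ((t.card : ℝ) - (m₀ + 1)) ^ 2 * ∏ k ∈ t, x k := by
    have h1 := variance_ge hx ((m₀ : ℝ) + 1)
    have hZpos : 0 < ∏ k ∈ s, (1 + x k) := prod_pos fun k hk => by linarith [hx k hk]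
    calc 12 * esy[x, s, m₀ + 1] ≤ 12 * ∏ k ∈ s, (1 + x k) := by linarith
      _ < (∏ k ∈ s, (1 + x k)) * ∑ k ∈ s, x k / (1 + x k) ^ 2 := by nlinarith
      _ ≤ _ := by exact_mod_cast h1
  exact ⟨esy_lt_two_mul_esy_pred hx m₀ hm hsym.ge hvar,
    esy_lt_two_mul_esy_succ hx m₀ hm hsym.le hvar⟩

end Summit.HubbardSuperconductivity.HubbardSuperconductivity.Theorems.CanonicalOccupation
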